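import Mathlib
import Summits.CriticalPhenomena.CardyFormulaZ2.Theorems.CardySelfRefinementDefs
import Summits.CriticalPhenomena.CardyFormulaZ2.Theorems.CardySelfRefinementRussoDriftModel
import Summits.CriticalPhenomena.CardyFormulaZ2.Theorems.CardySelfRefinementGradientComparabilityStubDcEqSumPivotal
import Summits.CriticalPhenomena.CardyFormulaZ2.Theorems.CardySelfRefinementGradientComparabilityStubRussoWithinSigned
import Literature.Probability.LatticeModels.ProdBernoulliIndependence
import HarnessLib

/-!
# Crux `GradientComparability` (stmt-CriticalPhenomena-10269), line `monotone-product-coordinates` —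
# stub `stub_cornerHardWayBoxes` (HWB), brick (ii-ρ): the `ρ`-leg is dominated by the shared-coin leg

Route `CardySelfRefinement`; vocabulary from `CardySelfRefinementDefs` (`ax tb opn cfg`).

The revised route to (HWB) (Aizenman–Grimmett integration in the three-parameter family
`M_k(ρ, c; p)`: the coin law with own coins fair on axial edges and of bias `c` on interior edges,
SHARED coins of bias `p`, selectors of bias `ρ`, pushed forward by the read-out `cfg k`) needs,
besides the endpoint brick `hardWayBoxes_one_of_half_lt` (`…StubCornerHWBCoarse`), two
differential inequalities for the probability `F(ρ, p, c)` of an increasing cylinder event `X`.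
This file proves the cheap one, **(ii-ρ)**: `|∂ρF| ≤ 2 ∂pF` for `ρ ≥ 1/2`
(`abs_derivWithin_selector_le_two_mul_derivWithin_shared`, REGISTERED).

## Mathematics (exact two-coin surgery at a bundle; Russo 1981 §4 Lemma 3 / Grimmett 1999 Thm 2.25)

Fix a bundle `(t, d)` with selector `σ = (t,d,2)` and shared coin `sh = (t,d,1)`; no edge outside
the bundle reads `σ` or `sh`, and a sub-edge reads `(σ ∧ sh) ∨ (¬σ ∧ own)`.  Hence every coin
sample agreeing with `S` off `{σ, sh}` reads out between `lo S = S ∪ {σ} ∖ {sh}` (bundle closed)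
and `hi S = S ∪ {σ, sh}` (bundle open) (`cfg_sandwich`), and with the selector OFF the shared
coin is unread (`cfg_eq_of_selector_notMem`).  For the pulled-back increasing event
`E = cfg k ⁻¹' X` put `Hi = {S | hi S ∈ E} ⊇ Lo = {S | lo S ∈ E}` (both ignore `σ`, `sh`).  Then
* both Russo terms of the selector, `P{S ∪ {σ} ∈ E}` and `P{S ∖ {σ} ∈ E}`, lie in `[P Lo, P Hi]`, so
  the selector influence has `|Infl σ| ≤ P Hi − P Lo` (`abs_selector_infl_le`);
* `{S ∪ {sh} ∈ E} = ({σ ∈ S} ∩ Hi) ∪ ({σ ∉ S} ∩ E)` and `{S ∖ {sh} ∈ E} = ({σ ∈ S} ∩ Lo) ∪ ({σ ∉ S} ∩ E)`,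
  so by independence `Infl sh = q_σ · (P Hi − P Lo)` for ANY product coin law `q`
  (`shared_infl_eq`), whence `q_σ · |Infl σ| ≤ Infl sh` (`selector_infl_abs_le_shared_infl`).
Summing over bundles (Russo within `[0,1]`, `hasDerivWithinAt_real_layer`): `|∂ρF| ≤ ∂pF / ρ ≤ 2 ∂pF`. -/

noncomputable section

namespace Summit.CriticalPhenomena.CardyFormulaZ2.Theorems.CardySelfRefinement

open scoped Topology
open Filter Set MeasureTheory
open Literature.Probability.LatticeModels Literature.Probability.Percolation
open Literature.Probability.Percolation.QuadCrossing
open Summit.CriticalPhenomena.CardyFormulaZ2.Theses.CardySelfRefinement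

/-- The three-parameter coin law of `M_k(ρ, c; p)` (local notation; written inline in the registered
statement): own coins fair on axial edges and `c` on interior edges, shared coins `p`, selectors `ρ`. -/
local notation3 (prettyPrint := false) "prm₃(" k ", " ρ ", " p ", " c ")" =>
  (fun i : Site 2 × Fin 2 × Fin 3 =>
    if i.2.2 = 0 then (if ax k (i.1, i.2.1) then half else Set.projIcc (0 : ℝ) 1 zero_le_one c)
    else if i.2.2 = 1 then Set.projIcc (0 : ℝ) 1 zero_le_one p
    else Set.projIcc (0 : ℝ) 1 zero_le_one ρ : Site 2 × Fin 2 × Fin 3 → unitInterval)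

/-! ## Two-coin surgery at a bundle: the selector and the shared coin -/

/-- A sub-edge `vd` of the bundle `(t, d)` (axial, coarse base `t`, direction `d`) reads
(selector on and shared coin on) or (selector off and own coin on). -/
theorem opn_iff_of_bundle (k : ℕ) {t : Site 2} {d : Fin 2} (T : Set (Site 2 × Fin 2 × Fin 3))
    {vd : Site 2 × Fin 2} (h : ax k vd ∧ tb k vd = t ∧ vd.2 = d) :
    opn k T vd ↔ ((t, d, (2 : Fin 3)) ∈ T ∧ (t, d, (1 : Fin 3)) ∈ T) ∨
      ((t, d, (2 : Fin 3)) ∉ T ∧ (vd.1, d, (0 : Fin 3)) ∈ T) := by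
  obtain ⟨hax, htb, hd⟩ := h
  show (if ax k vd then _ else _) ↔ _
  rw [if_pos hax, htb, hd]

/-- An edge which is not a sub-edge of the bundle `(t, d)` reads neither the selector `(t,d,2)`
nor the shared coin `(t,d,1)`: coin samples agreeing off these two coins give it the same
read-out. -/
theorem opn_congr_off_selector_shared (k : ℕ) {t : Site 2} {d : Fin 2}
    {T T' : Set (Site 2 × Fin 2 × Fin 3)}
    (h : ∀ x : Site 2 × Fin 2 × Fin 3, x ≠ (t, d, (2 : Fin 3)) → x ≠ (t, d, (1 : Fin 3)) →
      (x ∈ T ↔ x ∈ T'))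
    {vd : Site 2 × Fin 2} (hvd : ¬ (ax k vd ∧ tb k vd = t ∧ vd.2 = d)) :
    opn k T vd ↔ opn k T' vd := by
  obtain ⟨v, d'⟩ := vd
  have h0 : (v, d', (0 : Fin 3)) ∈ T ↔ (v, d', (0 : Fin 3)) ∈ T' := h _ (by simp) (by simp)
  by_cases hax : ax k (v, d')
  · have hne : ¬ (tb k (v, d') = t ∧ d' = d) := fun h' => hvd ⟨hax, h'.1, h'.2⟩
    have h1 : (tb k (v, d'), d', (1 : Fin 3)) ∈ T ↔ (tb k (v, d'), d', (1 : Fin 3)) ∈ T' := by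
      refine h _ (by simp) fun hx => hne ?_
      simp only [Prod.mk.injEq] at hx
      exact ⟨hx.1, hx.2.1⟩
    have h2 : (tb k (v, d'), d', (2 : Fin 3)) ∈ T ↔ (tb k (v, d'), d', (2 : Fin 3)) ∈ T' := by
      refine h _ (fun hx => hne ?_) (by simp)
      simp only [Prod.mk.injEq] at hx
      exact ⟨hx.1, hx.2.1⟩
    simp only [opn, if_pos hax, h0, h1, h2]
  · simp only [opn, if_neg hax, h0]

/-- The read-out `cfg` is monotone along any implication of edge read-outs. -/
theorem cfg_subset_cfg_of_opn (k : ℕ) {T T' : Set (Site 2 × Fin 2 × Fin 3)}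
    (h : ∀ vd : Site 2 × Fin 2, opn k T vd → opn k T' vd) : cfg k T ⊆ cfg k T' :=
  fun _ ⟨v, d', he, hopn⟩ => ⟨v, d', he, h _ hopn⟩

/-- **Sandwich.**  Every coin sample `T` agreeing with `S` off the selector and the shared coin of
the bundle `(t, d)` reads out between "selector on, shared coin off" (bundle closed) and
"selector on, shared coin on" (bundle open). -/
theorem cfg_sandwich (k : ℕ) (t : Site 2) (d : Fin 2) {S T : Set (Site 2 × Fin 2 × Fin 3)}
    (h : ∀ x : Site 2 × Fin 2 × Fin 3, x ≠ (t, d, (2 : Fin 3)) → x ≠ (t, d, (1 : Fin 3)) →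
      (x ∈ T ↔ x ∈ S)) :
    cfg k (insert (t, d, (2 : Fin 3)) S \ {(t, d, (1 : Fin 3))}) ⊆ cfg k T ∧
      cfg k T ⊆ cfg k (insert (t, d, (2 : Fin 3)) (insert (t, d, (1 : Fin 3)) S)) := by
  refine ⟨cfg_subset_cfg_of_opn k fun vd hopn => ?_, cfg_subset_cfg_of_opn k fun vd hopn => ?_⟩
  · by_cases hb : ax k vd ∧ tb k vd = t ∧ vd.2 = d
    · rw [opn_iff_of_bundle k _ hb] at hopn
      rcases hopn with ⟨-, h1⟩ | ⟨h2, -⟩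
      · exact absurd (Set.mem_singleton _) h1.2
      · exact absurd ⟨Set.mem_insert _ _, by simp⟩ h2
    · refine (opn_congr_off_selector_shared k (fun x hx2 hx1 => ?_) hb).1 hopn
      rw [h x hx2 hx1]
      simp [hx2, hx1]
  · by_cases hb : ax k vd ∧ tb k vd = t ∧ vd.2 = d
    · rw [opn_iff_of_bundle k _ hb]
      exact Or.inl ⟨Set.mem_insert _ _, Set.mem_insert_of_mem _ (Set.mem_insert _ _)⟩
    · refine (opn_congr_off_selector_shared k (fun x hx2 hx1 => ?_) hb).1 hopn
      rw [h x hx2 hx1]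
      simp [hx2, hx1]

/-- **Selector off ⇒ shared coin unread.**  Two coin samples in which the selector of the bundle
`(t, d)` is off and which agree off its shared coin have the same read-out. -/
theorem cfg_eq_of_selector_notMem (k : ℕ) (t : Site 2) (d : Fin 2)
    {T T' : Set (Site 2 × Fin 2 × Fin 3)} (hT : (t, d, (2 : Fin 3)) ∉ T)
    (hT' : (t, d, (2 : Fin 3)) ∉ T')
    (h : ∀ x : Site 2 × Fin 2 × Fin 3, x ≠ (t, d, (1 : Fin 3)) → (x ∈ T ↔ x ∈ T')) :
    cfg k T = cfg k T' := by
  have key : ∀ vd : Site 2 × Fin 2, opn k T vd ↔ opn k T' vd := by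
    intro vd
    by_cases hb : ax k vd ∧ tb k vd = t ∧ vd.2 = d
    · have h0 : (vd.1, d, (0 : Fin 3)) ∈ T ↔ (vd.1, d, (0 : Fin 3)) ∈ T' := h _ (by simp)
      rw [opn_iff_of_bundle k T hb, opn_iff_of_bundle k T' hb]
      simp only [hT, hT', false_and, false_or, not_false_eq_true, true_and, h0]
    · exact opn_congr_off_selector_shared k (fun x _ hx1 => h x hx1) hb
  exact Set.Subset.antisymm (cfg_subset_cfg_of_opn k fun vd => (key vd).1)
    (cfg_subset_cfg_of_opn k fun vd => (key vd).2)

/-! ## The two Russo terms of the selector and the influence of the shared coin -/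

/-- For an increasing `X`, both Russo terms of the selector of the bundle `(t, d)` (selector forced
on, selector forced off) are implied by `Lo = {S | S ∪ {σ} ∖ {sh} ∈ E}` and imply
`Hi = {S | S ∪ {σ, sh} ∈ E}`, `E = cfg k ⁻¹' X`. -/
theorem selector_terms_sandwich (k : ℕ) (t : Site 2) (d : Fin 2) {X : Set (BondConfig (Site 2))}
    (hX : IsUpperSet X) (S : Set (Site 2 × Fin 2 × Fin 3)) :
    (insert (t, d, (2 : Fin 3)) S \ {(t, d, (1 : Fin 3))} ∈ (cfg k) ⁻¹' X →
        insert (t, d, (2 : Fin 3)) S ∈ (cfg k) ⁻¹' X) ∧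
      (insert (t, d, (2 : Fin 3)) S ∈ (cfg k) ⁻¹' X →
        insert (t, d, (2 : Fin 3)) (insert (t, d, (1 : Fin 3)) S) ∈ (cfg k) ⁻¹' X) ∧
      (insert (t, d, (2 : Fin 3)) S \ {(t, d, (1 : Fin 3))} ∈ (cfg k) ⁻¹' X →
        S \ {(t, d, (2 : Fin 3))} ∈ (cfg k) ⁻¹' X) ∧
      (S \ {(t, d, (2 : Fin 3))} ∈ (cfg k) ⁻¹' X →
        insert (t, d, (2 : Fin 3)) (insert (t, d, (1 : Fin 3)) S) ∈ (cfg k) ⁻¹' X) := by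
  have h1 := cfg_sandwich k t d (S := S) (T := insert (t, d, (2 : Fin 3)) S)
    fun x hx2 _ => by simp [hx2]
  have h2 := cfg_sandwich k t d (S := S) (T := S \ {(t, d, (2 : Fin 3))})
    fun x hx2 _ => by simp [hx2]
  exact ⟨fun h => hX h1.1 h, fun h => hX h1.2 h, fun h => hX h2.1 h, fun h => hX h2.2 h⟩

/-- **The selector influence is at most `P Hi − P Lo`** (any finite measure on coin samples):
both Russo terms of the selector lie in `[P Lo, P Hi]`. -/
theorem abs_selector_infl_le (k : ℕ) (t : Site 2) (d : Fin 2) {X : Set (BondConfig (Site 2))}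
    (hX : IsUpperSet X) (ν : Measure (Set (Site 2 × Fin 2 × Fin 3))) [IsFiniteMeasure ν] :
    |ν.real {S | insert (t, d, (2 : Fin 3)) S ∈ (cfg k) ⁻¹' X} -
        ν.real {S | S \ {(t, d, (2 : Fin 3))} ∈ (cfg k) ⁻¹' X}| ≤
      ν.real {S | insert (t, d, (2 : Fin 3)) (insert (t, d, (1 : Fin 3)) S) ∈ (cfg k) ⁻¹' X} -
        ν.real {S | insert (t, d, (2 : Fin 3)) S \ {(t, d, (1 : Fin 3))} ∈ (cfg k) ⁻¹' X} := by
  have h := fun S => selector_terms_sandwich k t d hX S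
  rw [abs_sub_le_iff]
  exact ⟨sub_le_sub (measureReal_mono (fun S hS => (h S).2.1 hS) (measure_ne_top _ _))
      (measureReal_mono (fun S hS => (h S).2.2.1 hS) (measure_ne_top _ _)),
    sub_le_sub (measureReal_mono (fun S hS => (h S).2.2.2 hS) (measure_ne_top _ _))
      (measureReal_mono (fun S hS => (h S).1 hS) (measure_ne_top _ _))⟩

/-- **The influence of the shared coin of the bundle `(t, d)` is `q_σ · (P Hi − P Lo)`** under any
product coin law `q` (`q_σ` the bias of the selector): split on the selector; with the selector
on, opening/closing the shared coin gives `hi S`/`lo S`; with the selector off the shared coin is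
unread; the selector is independent of `Hi`, `Lo`. -/
theorem shared_infl_eq (k : ℕ) (t : Site 2) (d : Fin 2) {X : Set (BondConfig (Site 2))}
    (hXm : MeasurableSet X) (q : Site 2 × Fin 2 × Fin 3 → unitInterval) :
    (prodBernoulli q).real {S | insert (t, d, (1 : Fin 3)) S ∈ (cfg k) ⁻¹' X} -
        (prodBernoulli q).real {S | S \ {(t, d, (1 : Fin 3))} ∈ (cfg k) ⁻¹' X} =
      (q (t, d, (2 : Fin 3)) : ℝ) *
        ((prodBernoulli q).real {S | insert (t, d, (2 : Fin 3)) (insert (t, d, (1 : Fin 3)) S) ∈ (cfg k) ⁻¹' X} -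
          (prodBernoulli q).real {S | insert (t, d, (2 : Fin 3)) S \ {(t, d, (1 : Fin 3))} ∈ (cfg k) ⁻¹' X}) := by
  classical
  set E : Set (Set (Site 2 × Fin 2 × Fin 3)) := (cfg k) ⁻¹' X with hE
  have hEm : MeasurableSet E := measurable_cfg k hXm
  have hne : ((t, d, (2 : Fin 3)) : Site 2 × Fin 2 × Fin 3) ≠ (t, d, (1 : Fin 3)) := by simp
  -- the two decompositions along the selector
  have hins : {S | insert (t, d, (1 : Fin 3)) S ∈ E} =
      ({S | (t, d, (2 : Fin 3)) ∈ S} ∩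
          {S | insert (t, d, (2 : Fin 3)) (insert (t, d, (1 : Fin 3)) S) ∈ E}) ∪
        ({S | (t, d, (2 : Fin 3)) ∈ S}ᶜ ∩ E) := by
    ext S
    by_cases hS : (t, d, (2 : Fin 3)) ∈ S
    · have heq : insert (t, d, (2 : Fin 3)) (insert (t, d, (1 : Fin 3)) S) =
          insert (t, d, (1 : Fin 3)) S := Set.insert_eq_of_mem (Set.mem_insert_of_mem _ hS)
      simp [hS, heq]
    · have heq : cfg k (insert (t, d, (1 : Fin 3)) S) = cfg k S :=
        cfg_eq_of_selector_notMem k t d (by simp [hS]) hS fun x hx => by simp [hx]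
      simp [hS, hE, heq]
  have hdel : {S | S \ {(t, d, (1 : Fin 3))} ∈ E} =
      ({S | (t, d, (2 : Fin 3)) ∈ S} ∩
          {S | insert (t, d, (2 : Fin 3)) S \ {(t, d, (1 : Fin 3))} ∈ E}) ∪
        ({S | (t, d, (2 : Fin 3)) ∈ S}ᶜ ∩ E) := by
    ext S
    by_cases hS : (t, d, (2 : Fin 3)) ∈ S
    · have heq : insert (t, d, (2 : Fin 3)) S = S := Set.insert_eq_of_mem hS
      simp [hS, heq]
    · have heq : cfg k (S \ {(t, d, (1 : Fin 3))}) = cfg k S :=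
        cfg_eq_of_selector_notMem k t d (by simp [hS]) hS fun x hx => by simp [hx]
      simp [hS, hE, heq]
  -- independence of the selector from `Hi`, `Lo`
  have hAm : MeasurableSet {S : Set (Site 2 × Fin 2 × Fin 3) | (t, d, (2 : Fin 3)) ∈ S} :=
    (measurable_set_mem _).setOf
  have hHim : MeasurableSet {S | insert (t, d, (2 : Fin 3)) (insert (t, d, (1 : Fin 3)) S) ∈ E} :=
    ((measurable_insert_pt _).comp (measurable_insert_pt _)) hEm
  have hLom : MeasurableSet {S | insert (t, d, (2 : Fin 3)) S \ {(t, d, (1 : Fin 3))} ∈ E} :=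
    ((measurable_sdiff_pt _).comp (measurable_insert_pt _)) hEm
  have hAdet : DeterminedBy {S : Set (Site 2 × Fin 2 × Fin 3) | (t, d, (2 : Fin 3)) ∈ S}
      (↑({(t, d, (2 : Fin 3))} : Finset (Site 2 × Fin 2 × Fin 3)) : Set _) := by
    rw [determinedBy_iff]
    intro S₁ S₂ hS
    have hx : ((t, d, (2 : Fin 3)) : Site 2 × Fin 2 × Fin 3) ∈
        (↑({(t, d, (2 : Fin 3))} : Finset (Site 2 × Fin 2 × Fin 3)) : Set _) := by simp
    exact ⟨fun h1 => ((Set.ext_iff.1 hS _).1 ⟨h1, hx⟩).1, fun h2 => ((Set.ext_iff.1 hS _).2 ⟨h2, hx⟩).1⟩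
  have hkey : ∀ S : Set (Site 2 × Fin 2 × Fin 3), insert (t, d, (2 : Fin 3)) S =
      insert (t, d, (2 : Fin 3)) (S ∩ (↑({(t, d, (2 : Fin 3))} : Finset (Site 2 × Fin 2 × Fin 3)) : Set _)ᶜ) := by
    intro S
    rw [Finset.coe_singleton, ← Set.sdiff_eq, Set.insert_sdiff_singleton]
  have hHidet : DeterminedBy {S | insert (t, d, (2 : Fin 3)) (insert (t, d, (1 : Fin 3)) S) ∈ E}
      (↑({(t, d, (2 : Fin 3))} : Finset (Site 2 × Fin 2 × Fin 3)) : Set _)ᶜ := by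
    rw [determinedBy_iff]
    intro S₁ S₂ hS
    simp only [Set.mem_setOf_eq]
    rw [Set.insert_comm, hkey, hS, ← hkey, Set.insert_comm]
  have hLodet : DeterminedBy {S | insert (t, d, (2 : Fin 3)) S \ {(t, d, (1 : Fin 3))} ∈ E}
      (↑({(t, d, (2 : Fin 3))} : Finset (Site 2 × Fin 2 × Fin 3)) : Set _)ᶜ := by
    rw [determinedBy_iff]
    intro S₁ S₂ hS
    simp only [Set.mem_setOf_eq]
    rw [hkey, hS, ← hkey]
  have hdisj1 : Disjoint ({S | (t, d, (2 : Fin 3)) ∈ S} ∩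
      {S | insert (t, d, (2 : Fin 3)) (insert (t, d, (1 : Fin 3)) S) ∈ E})
      ({S | (t, d, (2 : Fin 3)) ∈ S}ᶜ ∩ E) :=
    Set.disjoint_left.2 fun S hS hS' => hS'.1 hS.1
  have hdisj2 : Disjoint ({S | (t, d, (2 : Fin 3)) ∈ S} ∩
      {S | insert (t, d, (2 : Fin 3)) S \ {(t, d, (1 : Fin 3))} ∈ E})
      ({S | (t, d, (2 : Fin 3)) ∈ S}ᶜ ∩ E) :=
    Set.disjoint_left.2 fun S hS hS' => hS'.1 hS.1
  rw [hins, hdel, measureReal_union hdisj1 (hAm.compl.inter hEm),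
    measureReal_union hdisj2 (hAm.compl.inter hEm),
    prodBernoulli_real_inter_of_determinedBy q _ hAdet hHidet hAm hHim,
    prodBernoulli_real_inter_of_determinedBy q _ hAdet hLodet hAm hLom, prodBernoulli_real_setOf_mem]
  ring

/-- **Per-bundle domination `q_σ · |Infl σ| ≤ Infl sh`**: for an increasing measurable `X` and
any product coin law `q`, the selector influence of the bundle `(t, d)` times the selector bias
is at most the (nonnegative) influence of its shared coin. -/
theorem selector_infl_abs_le_shared_infl (k : ℕ) (t : Site 2) (d : Fin 2)
    {X : Set (BondConfig (Site 2))} (hX : IsUpperSet X) (hXm : MeasurableSet X)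
    (q : Site 2 × Fin 2 × Fin 3 → unitInterval) :
    (q (t, d, (2 : Fin 3)) : ℝ) * |(prodBernoulli q).real {S | insert (t, d, (2 : Fin 3)) S ∈ (cfg k) ⁻¹' X} -
        (prodBernoulli q).real {S | S \ {(t, d, (2 : Fin 3))} ∈ (cfg k) ⁻¹' X}| ≤
      (prodBernoulli q).real {S | insert (t, d, (1 : Fin 3)) S ∈ (cfg k) ⁻¹' X} -
        (prodBernoulli q).real {S | S \ {(t, d, (1 : Fin 3))} ∈ (cfg k) ⁻¹' X} := by
  rw [shared_infl_eq k t d hXm q]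
  exact mul_le_mul_of_nonneg_left (abs_selector_infl_le k t d hX _) (unitInterval.nonneg _)

/-- The influence of a shared coin on an increasing measurable event is nonnegative. -/
theorem shared_infl_nonneg (k : ℕ) (t : Site 2) (d : Fin 2) {X : Set (BondConfig (Site 2))}
    (hX : IsUpperSet X) (hXm : MeasurableSet X) (q : Site 2 × Fin 2 × Fin 3 → unitInterval) :
    0 ≤ (prodBernoulli q).real {S | insert (t, d, (1 : Fin 3)) S ∈ (cfg k) ⁻¹' X} -
        (prodBernoulli q).real {S | S \ {(t, d, (1 : Fin 3))} ∈ (cfg k) ⁻¹' X} :=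
  le_trans (mul_nonneg (unitInterval.nonneg _) (abs_nonneg _))
    (selector_infl_abs_le_shared_infl k t d hX hXm q)

/-! ## Russo's formula, one coin layer at a time, summed over bundles -/

/-- **Russo along a one-layer path, bundle form.**  If along `b ↦ q b` exactly the coins of layer
`j₀` move, with unit speed (within `s` at `β`), and `E` is determined by the coins of the finite
bundle set `T`, then `b ↦ P_{q b}(E)` has derivative `Σ_{(t,d) ∈ T} Infl (t, d, j₀)` within `s`
at `β` (`stub_russoWithin_signed`, reindexed by bundles and layers). -/
theorem hasDerivWithinAt_real_layer {q : ℝ → Site 2 × Fin 2 × Fin 3 → unitInterval} {s : Set ℝ}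
    {β : ℝ} (j₀ : Fin 3)
    (h1 : ∀ (x : Site 2) (e : Fin 2), HasDerivWithinAt (fun b => (q b (x, e, j₀) : ℝ)) 1 s β)
    (h0 : ∀ (x : Site 2) (e : Fin 2) (j : Fin 3), j ≠ j₀ →
      HasDerivWithinAt (fun b => (q b (x, e, j) : ℝ)) 0 s β)
    {E : Set (Set (Site 2 × Fin 2 × Fin 3))} (T : Finset (Site 2 × Fin 2))
    (hE : DeterminedBy E ↑((T ×ˢ (Finset.univ : Finset (Fin 3))).map
      (Equiv.prodAssoc (Site 2) (Fin 2) (Fin 3)).toEmbedding)) :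
    HasDerivWithinAt (fun b => (prodBernoulli (q b)).real E)
      (∑ td ∈ T, ((prodBernoulli (q β)).real {S | insert (td.1, td.2, j₀) S ∈ E} -
        (prodBernoulli (q β)).real {S | S \ {(td.1, td.2, j₀)} ∈ E})) s β := by
  classical
  have hp : ∀ i ∈ (T ×ˢ (Finset.univ : Finset (Fin 3))).map
      (Equiv.prodAssoc (Site 2) (Fin 2) (Fin 3)).toEmbedding,
      HasDerivWithinAt (fun b => (q b i : ℝ))
        ((fun i : Site 2 × Fin 2 × Fin 3 => if i.2.2 = j₀ then (1 : ℝ) else 0) i) s β := by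
    rintro ⟨x, e, j⟩ -
    dsimp only
    by_cases hj : j = j₀
    · rw [if_pos hj, hj]
      exact h1 x e
    · rw [if_neg hj]
      exact h0 x e j hj
  have h := stub_russoWithin_signed q E hE s β
    (fun i : Site 2 × Fin 2 × Fin 3 => if i.2.2 = j₀ then (1 : ℝ) else 0) hp
  convert h using 1
  rw [Finset.sum_map, Finset.sum_product]
  refine Finset.sum_congr rfl fun td _ => ?_
  simp [ite_mul, Finset.sum_ite_eq']

/-- Russo for the three-parameter family in the selector bias `ρ ∈ [0,1]` (within `[0,1]`):
`∂ρ P(E) = Σ_{(t,d) ∈ T} Infl (t, d, 2)`. -/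
theorem hasDerivWithinAt_real_rho (k : ℕ) (p c : ℝ) {ρ : ℝ} (hρ : ρ ∈ Set.Icc (0 : ℝ) 1)
    {E : Set (Set (Site 2 × Fin 2 × Fin 3))} (T : Finset (Site 2 × Fin 2))
    (hE : DeterminedBy E ↑((T ×ˢ (Finset.univ : Finset (Fin 3))).map
      (Equiv.prodAssoc (Site 2) (Fin 2) (Fin 3)).toEmbedding)) :
    HasDerivWithinAt (fun b => (prodBernoulli prm₃(k, b, p, c)).real E)
      (∑ td ∈ T, ((prodBernoulli prm₃(k, ρ, p, c)).real {S | insert (td.1, td.2, (2 : Fin 3)) S ∈ E} -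
        (prodBernoulli prm₃(k, ρ, p, c)).real {S | S \ {(td.1, td.2, (2 : Fin 3))} ∈ E}))
      (Set.Icc 0 1) ρ := by
  refine hasDerivWithinAt_real_layer (q := fun b => prm₃(k, b, p, c)) 2 (fun x e => ?_)
    (fun x e j hj => ?_) T hE
  · refine (hasDerivWithinAt_id ρ _).congr_of_mem (fun b hb => ?_) hρ
    simp [Set.projIcc_of_mem _ hb]
  · have hc : (fun b : ℝ => ((prm₃(k, b, p, c)) (x, e, j) : ℝ)) =
        fun _ => ((prm₃(k, 0, p, c)) (x, e, j) : ℝ) := by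
      funext b
      fin_cases j
      · simp
      · simp
      · exact absurd rfl hj
    rw [hc]
    exact hasDerivWithinAt_const _ _ _

/-- Russo for the three-parameter family in the shared-coin bias `p ∈ [0,1]` (within `[0,1]`):
`∂p P(E) = Σ_{(t,d) ∈ T} Infl (t, d, 1)`. -/
theorem hasDerivWithinAt_real_shared (k : ℕ) (ρ c : ℝ) {p : ℝ} (hp : p ∈ Set.Icc (0 : ℝ) 1)
    {E : Set (Set (Site 2 × Fin 2 × Fin 3))} (T : Finset (Site 2 × Fin 2))
    (hE : DeterminedBy E ↑((T ×ˢ (Finset.univ : Finset (Fin 3))).map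
      (Equiv.prodAssoc (Site 2) (Fin 2) (Fin 3)).toEmbedding)) :
    HasDerivWithinAt (fun b => (prodBernoulli prm₃(k, ρ, b, c)).real E)
      (∑ td ∈ T, ((prodBernoulli prm₃(k, ρ, p, c)).real {S | insert (td.1, td.2, (1 : Fin 3)) S ∈ E} -
        (prodBernoulli prm₃(k, ρ, p, c)).real {S | S \ {(td.1, td.2, (1 : Fin 3))} ∈ E}))
      (Set.Icc 0 1) p := by
  refine hasDerivWithinAt_real_layer (q := fun b => prm₃(k, ρ, b, c)) 1 (fun x e => ?_)
    (fun x e j hj => ?_) T hE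
  · refine (hasDerivWithinAt_id p _).congr_of_mem (fun b hb => ?_) hp
    simp [Set.projIcc_of_mem _ hb]
  · have hc : (fun b : ℝ => ((prm₃(k, ρ, b, c)) (x, e, j) : ℝ)) =
        fun _ => ((prm₃(k, ρ, 0, c)) (x, e, j) : ℝ) := by
      funext b
      fin_cases j
      · simp
      · exact absurd rfl hj
      · simp
    rw [hc]
    exact hasDerivWithinAt_const _ _ _

/-- Elementary: `1/2 ≤ q` and `q |I| ≤ J` give `|I| ≤ 2 J`. -/
theorem abs_le_two_mul_of_half_le {q I J : ℝ} (hq : 1 / 2 ≤ q) (h : q * |I| ≤ J) : |I| ≤ 2 * J := by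
  nlinarith [abs_nonneg I]

/-- **Brick (ii-ρ) of stub `stub_cornerHardWayBoxes` (HWB): the `ρ`-leg is dominated by the
shared-coin leg.**  For every `k`, every increasing measurable event `X` of bond configurations
whose pull-back `cfg k ⁻¹' X` is determined by finitely many coins, every `ρ ∈ [1/2, 1]`,
`p ∈ [0, 1]` and `c`, in the three-parameter family `M_k(ρ, c; p)` (own coins fair on axial edges
and `c` on interior edges, shared coins `p`, selectors `ρ`, clamped to `[0,1]`, pushed forward by
`cfg k`): `|∂ρ M_k(ρ,c;p)(X)| ≤ 2 ∂p M_k(ρ,c;p)(X)` (one-sided derivatives within `[0,1]`). -/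
theorem abs_derivWithin_selector_le_two_mul_derivWithin_shared : ∀ k : ℕ, ∀ X : Set (BondConfig (Site 2)), IsUpperSet X → MeasurableSet X → ∀ K : Finset (Site 2 × Fin 2 × Fin 3), DeterminedBy ((cfg k) ⁻¹' X) (↑K : Set (Site 2 × Fin 2 × Fin 3)) → ∀ ρ ∈ Set.Icc (1 / 2 : ℝ) 1, ∀ p ∈ Set.Icc (0 : ℝ) 1, ∀ c : ℝ, |derivWithin (fun ρ' => ((prodBernoulli (fun i : Site 2 × Fin 2 × Fin 3 => if i.2.2 = 0 then (if ax k (i.1, i.2.1) then half else Set.projIcc (0 : ℝ) 1 zero_le_one c) else if i.2.2 = 1 then Set.projIcc (0 : ℝ) 1 zero_le_one p else Set.projIcc (0 : ℝ) 1 zero_le_one ρ')).map (cfg k)).real X) (Set.Icc 0 1) ρ| ≤ 2 * derivWithin (fun p' => ((prodBernoulli (fun i : Site 2 × Fin 2 × Fin 3 => if i.2.2 = 0 then (if ax k (i.1, i.2.1) then half else Set.projIcc (0 : ℝ) 1 zero_le_one c) else if i.2.2 = 1 then Set.projIcc (0 : ℝ) 1 zero_le_one p' else Set.projIcc (0 :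 ℝ) 1 zero_le_one ρ)).map (cfg k)).real X) (Set.Icc 0 1) p := by
  classical
  intro k X hX hXm K hK ρ hρ p hp c
  -- enlarge the coin set to whole bundles
  set T : Finset (Site 2 × Fin 2) := K.image fun i => (i.1, i.2.1) with hT
  have hE : DeterminedBy ((cfg k) ⁻¹' X) ↑((T ×ˢ (Finset.univ : Finset (Fin 3))).map
      (Equiv.prodAssoc (Site 2) (Fin 2) (Fin 3)).toEmbedding) := by
    refine hK.mono fun i hi => Finset.mem_coe.2 (Finset.mem_map.2 ⟨((i.1, i.2.1), i.2.2),
      Finset.mem_product.2 ⟨Finset.mem_image_of_mem _ (Finset.mem_coe.1 hi), Finset.mem_univ _⟩,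
      rfl⟩)
  have hρ' : ρ ∈ Set.Icc (0 : ℝ) 1 := ⟨le_trans (by norm_num) hρ.1, hρ.2⟩
  have hF : ∀ ρ₁ p₁ : ℝ, ((prodBernoulli prm₃(k, ρ₁, p₁, c)).map (cfg k)).real X =
      (prodBernoulli prm₃(k, ρ₁, p₁, c)).real ((cfg k) ⁻¹' X) := fun ρ₁ p₁ =>
    map_measureReal_apply (measurable_cfg k) hXm
  simp only [hF]
  rw [(hasDerivWithinAt_real_rho k p c hρ' T hE).derivWithin (uniqueDiffOn_Icc zero_lt_one ρ hρ'),
    (hasDerivWithinAt_real_shared k ρ c hp T hE).derivWithin (uniqueDiffOn_Icc zero_lt_one p hp),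
    Finset.mul_sum]
  refine (Finset.abs_sum_le_sum_abs _ _).trans (Finset.sum_le_sum fun td _ => ?_)
  refine abs_le_two_mul_of_half_le ?_
    (selector_infl_abs_le_shared_infl k td.1 td.2 hX hXm prm₃(k, ρ, p, c))
  simpa [Set.projIcc_of_mem _ hρ'] using hρ.1

end Summit.CriticalPhenomena.CardyFormulaZ2.Theorems.CardySelfRefinement

end
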